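import Summits.AtomisticToContinuum.Crystallization.Theorems.ChartedZeroExcessLayeredLatticeLiouvilleTC

/-!
# Zero-excess layered lattice Liouville — part TD (lens-2 g32, node «HarmonicContraction», architecture (II) continued): the glue
`harmonicContractionPGLms_of_nine_pieces` — (HC) ⟸ (T) ∧ (U♮) ∧ (A0) ∧ (FF) ∧ (E) ∧ (A⁰) ∧ (D⁰) ∧ (C♭) ∧ (R_W), PROVED (THIN/FAT case split +
threading of constants, 0 sorry) — and the columns `_16XH7` (sixteen opaque leaves, residual (R_W) alone, the tree leaf (C) «CaccioppoliPGL» and the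
`s′ = 1/25` chart do NOT occur), `_16XH7W` ((A1) in place of (R_W) via the proved seam) and `_16XH7HC` (nothing lost: (HD) ∧ (C) verbatim through (HC)).
-/

noncomputable section

open scoped BigOperators InnerProductSpace RealInnerProductSpace
open MeasureTheory Set Metric Filter Topology
open Summit.AtomisticToContinuum.Crystallization.Theorems.ChartedPlanarOrderRigidityDoor
  (E3 IsClean IsNash IsCharted IsEStarGSC VisibleGap PertRegime atomsIn siteEnergy eStar BindingSurface)
open Summit.AtomisticToContinuum.Crystallization.Theorems.ChartedPlanarOrderDensityDichotomy (μS IsSep nK nK_nonneg excess)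
open Summit.AtomisticToContinuum.Crystallization.Theorems.ChartedPlanarOrderMesoCut (IsDoorSet NearHom LayeredHom EnvClose)
open Summit.AtomisticToContinuum.Crystallization.Theorems.OverbindingBudgetLiouvilleDictionary (NearHomBD)
open Summit.AtomisticToContinuum.Crystallization.Theorems.ChartedPlanarOrderDoorLayered
  (TwoPeriodic DoorPeriodic PeriodicBulkGapDoor gap_and_pert_1_50_of_periodic NearHomL2BD nearHomL2BD_mono nearHomBD_of_nearHomL2BD
   sq_le_finsum_mem not_nearHomL2BD_singleton envClose_mono Layered layeredHom_eq_layered atomsIn_subset)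
open Summit.AtomisticToContinuum.Crystallization.Theorems.ChartedPlanarOrderDoorLayeredOsc (IsTwoShellAffineGood DoorPeriodicOsc)
open Summit.AtomisticToContinuum.Crystallization.Theorems.ChartedPlanarOrderCleanScaleP
  (IsCleanP IsDoorSetP DoorPeriodicP isDoorSetP_mono doorPeriodic_of_doorPeriodicP isDoorSetP_one_iff doorPeriodicP_one_iff)
open Summit.AtomisticToContinuum.Crystallization.Theorems.ChartedPlanarOrderProfileSlavingLJ (pairForce)
open Literature.MathematicalPhysics.StatisticalMechanics (haggLabel barlowOffset layerNormal IsHaggSeq triangularVec₁ triangularVec₂)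

namespace Summit.AtomisticToContinuum.Crystallization.Theorems.ChartedZeroExcessLayeredLatticeLiouville

/-! ## §VII.1  ★★★ The glue of architecture (II): (HC) ⟸ (T) ∧ (U♮) ∧ (A0) ∧ (FF) ∧ (E) ∧ (A⁰) ∧ (D⁰) ∧ (C♭) ∧ (R_W) — PROVED

Order of constants (acyclic): `Cg` (A0) → `Cg' ≥ Cg` (R_W) → `C♭, C_A, C_D(C_A), C_ℓ` (C♭, A⁰, D⁰, E at `Cg'`) → given the target `c`:
`t := min (1/128) (c/(3C♭C_D + c))`, `ε := c·t⁵/(3C♭)`, `εw := c·t³/(3C♭)` → `εr(ε)`, `ϱ_A` (A⁰) → `εf := εr/(2C_ℓ)` → `ϱ_F` (FF) → `ϱ := max …` →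
`C_E(ϱ)` (E) → ceilings/floors, with the extra ceiling `η ≤ (εr/(2C_E))²` making `C_E√η + C_ℓ·εf ≤ εr`.  Per window: (A0) registers globally at `Cg`;
THIN windows (`η·nK < ϑ₀²/(2Cg)`) have NO `ϑ₀`-wild bond (`wildMass_eq_zero_of_registered`, PROVED) and keep `Ψ` (upgraded to `Cg'`), FAT windows are
re-registered by (R_W); then (FF) → (E) → (A⁰) → (D⁰) → (C♭), and the three levels `C♭·(ε/t⁵ + C_D·t² + εw/t³)·η` add up to `≤ c·η`. -/

/-- ★★★ **(HC) ⟸ the nine pieces (PROVED: THIN/FAT case split + threading of constants)**. [this file, g32] -/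
theorem harmonicContractionPGLms_of_nine_pieces {aHi Λ θ s : ℝ} (hT : TailDominationCert) (hU : UniformTameStability s Λ)
    (h0 : GlobalChartRegistrationP aHi Λ θ s) (hF : TailForceSlavingP aHi Λ θ s) (hE : LipDualLinearisationP aHi Λ θ s)
    (hA : L2HarmonicApproxP aHi Λ θ s) (hD : PositionDecayPL aHi Λ θ s) (hC : PositionCaccioppoliPG aHi Λ θ s)
    (hW : WildFractionPG aHi Λ θ s) : HarmonicContractionPGLms aHi Λ θ s := by
  intro hL hL' δ hδ a ha c hc
  -- (A0): the registration constant `Cg`; (R_W): the re-registration constant `Cg' ≥ Cg`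
  obtain ⟨Cg, hCg, η0, hη0, R0, hR0, h0'⟩ := h0 δ hδ a ha
  have hCg0 : 0 < Cg := zero_lt_one.trans_le hCg
  obtain ⟨Cg', hCgCg', hW'⟩ := hW δ hδ a ha Cg hCg
  have hCg' : 1 ≤ Cg' := hCg.trans hCgCg'
  -- (C♭), (A⁰), (D⁰), (E): their constants at `Cg'`
  obtain ⟨Cb, hCb, hC'⟩ := hC hT hU δ hδ a ha Cg' hCg'
  obtain ⟨CA, hCA, hA'⟩ := hA hT hU δ hδ a ha Cg' hCg'
  obtain ⟨CD, hCD, ϱD, hϱD, hD'⟩ := hD hT hU hL' δ hδ a ha Cg' hCg' CA hCA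
  obtain ⟨Cl, hCl, hE'⟩ := hE δ hδ a ha Cg' hCg'
  have hCb0 : 0 < Cb := zero_lt_one.trans_le hCb
  have hCD0 : 0 < CD := zero_lt_one.trans_le hCD
  have hCl0 : 0 < Cl := zero_lt_one.trans_le hCl
  -- the contraction ratio `t`, the closeness `ε`, the wild fraction `εw`
  set t : ℝ := min (1 / 128) (c / (3 * Cb * CD + c)) with ht_def
  have ht0 : 0 < t := lt_min (by norm_num) (by positivity)
  have ht128 : t ≤ 1 / 128 := min_le_left _ _
  have ht1 : t ≤ 1 := ht128.trans (by norm_num)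
  have hCbCDt : Cb * CD * t ≤ c / 3 := by
    have h1 : t ≤ c / (3 * Cb * CD + c) := min_le_right _ _
    rw [le_div_iff₀ (by positivity)] at h1
    nlinarith [mul_pos hCb0 hCD0, mul_nonneg hc.le ht0.le]
  have hCbCDt2 : Cb * CD * t ^ 2 ≤ c / 3 := by
    have ht2 : t ^ 2 ≤ t := by nlinarith
    exact (mul_le_mul_of_nonneg_left ht2 (by positivity)).trans hCbCDt
  set ε : ℝ := c * t ^ 5 / (3 * Cb) with hε_def
  have hε : 0 < ε := by positivity
  set εw : ℝ := c * t ^ 3 / (3 * Cb) with hεw_def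
  have hεw : 0 < εw := by positivity
  -- (A⁰) at `ε`: the residual tolerance `εr` and a range floor; (FF) at `εf := εr/(2C_ℓ)`: a range floor; the range `ϱ`
  obtain ⟨εr, hεr, ϱA, hϱA, hA''⟩ := hA' ε hε
  set εf : ℝ := εr / (2 * Cl) with hεf_def
  have hεf : 0 < εf := by positivity
  obtain ⟨ϱF, hϱF, hF'⟩ := hF δ hδ a ha Cg' hCg' εf hεf
  set ϱ : ℝ := max (max ϱA ϱD) (max ϱF 1) with hϱ_def
  have hϱA' : ϱA ≤ ϱ := (le_max_left _ _).trans (le_max_left _ _)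
  have hϱD' : ϱD ≤ ϱ := (le_max_right _ _).trans (le_max_left _ _)
  have hϱF' : ϱF ≤ ϱ := (le_max_left _ _).trans (le_max_right _ _)
  have hϱ1 : 1 ≤ ϱ := (le_max_right _ _).trans (le_max_right _ _)
  -- ceilings and floors of every piece at these constants
  obtain ⟨CE, hCE, ηE, hηE, RE, hRE, hE''⟩ := hE' ϱ hϱ1
  have hCE0 : 0 < CE := zero_lt_one.trans_le hCE
  obtain ⟨ηA, hηA, RA, hRA, hA'''⟩ := hA'' ϱ hϱA'
  obtain ⟨ηD, hηD, RD, hRD, hD''⟩ := hD' ϱ hϱD' t ht0 ht128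
  obtain ⟨ηF, hηF, RF, hRF, hF''⟩ := hF' ϱ hϱF'
  obtain ⟨ηb, hηb, Rb, hRb, hC''⟩ := hC' t ht0 ht128
  obtain ⟨ηW, hηW, RW, hRW, hW''⟩ :=
    hW' εw hεw (tameRadius ^ 2 / (2 * Cg)) (div_pos (pow_pos tameRadius_pos 2) (by positivity))
  -- the extra ceiling making the linearisation residual `≤ εr`
  set ηs : ℝ := (εr / (2 * CE)) ^ 2 with hηs_def
  have hηs : 0 < ηs := by positivity
  refine ⟨t, ht0, ht1, min (min (min η0 ηW) (min ηE ηA)) (min (min ηD ηF) (min ηb ηs)),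
    lt_min (lt_min (lt_min hη0 hηW) (lt_min hηE hηA)) (lt_min (lt_min hηD hηF) (lt_min hηb hηs)),
    max (max (max R0 RW) (max RE RA)) (max (max RD RF) Rb), lt_max_of_lt_left (lt_max_of_lt_left (lt_max_of_lt_left hR0)),
    fun S hSd hg η hη hηle R hR hms => ?_⟩
  have hη0' : η ≤ η0 := hηle.trans ((min_le_left _ _).trans ((min_le_left _ _).trans (min_le_left _ _)))
  have hηW' : η ≤ ηW := hηle.trans ((min_le_left _ _).trans ((min_le_left _ _).trans (min_le_right _ _)))
  have hηE' : η ≤ ηE := hηle.trans ((min_le_left _ _).trans ((min_le_right _ _).trans (min_le_left _ _)))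
  have hηA' : η ≤ ηA := hηle.trans ((min_le_left _ _).trans ((min_le_right _ _).trans (min_le_right _ _)))
  have hηD' : η ≤ ηD := hηle.trans ((min_le_right _ _).trans ((min_le_left _ _).trans (min_le_left _ _)))
  have hηF' : η ≤ ηF := hηle.trans ((min_le_right _ _).trans ((min_le_left _ _).trans (min_le_right _ _)))
  have hηb' : η ≤ ηb := hηle.trans ((min_le_right _ _).trans ((min_le_right _ _).trans (min_le_left _ _)))
  have hηs' : η ≤ ηs := hηle.trans ((min_le_right _ _).trans ((min_le_right _ _).trans (min_le_right _ _)))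
  have hR0' : R0 ≤ R := ((le_max_left _ _).trans ((le_max_left _ _).trans (le_max_left _ _))).trans hR
  have hRW' : RW ≤ R := ((le_max_right _ _).trans ((le_max_left _ _).trans (le_max_left _ _))).trans hR
  have hRE' : RE ≤ R := ((le_max_left _ _).trans ((le_max_right _ _).trans (le_max_left _ _))).trans hR
  have hRA' : RA ≤ R := ((le_max_right _ _).trans ((le_max_right _ _).trans (le_max_left _ _))).trans hR
  have hRD' : RD ≤ R := ((le_max_left _ _).trans ((le_max_left _ _).trans (le_max_right _ _))).trans hR
  have hRF' : RF ≤ R := ((le_max_right _ _).trans ((le_max_left _ _).trans (le_max_right _ _))).trans hR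
  have hRb' : Rb ≤ R := ((le_max_right _ _).trans (le_max_right _ _)).trans hR
  have hRpos : 0 < R := hR0.trans_le hR0'
  have hN : 0 ≤ nK (atomsIn (μS S) 0 R) := nK_nonneg _
  have hfin : (atomsIn (μS S) 0 R).Finite := finite_atomsIn hδ hSd.1.2.1 R
  -- (A0): one equilibrium chart and one global registration at `(Cg, η, R)`
  obtain ⟨L, w, hEq, Ψ, hG⟩ := h0' S hSd.1 hg η hη hη0' R hR0' hms
  -- THIN/FAT: a registration at `(Cg', η, R)` whose `ϑ₀`-wild mass is `≤ εw·η·nK(win R)`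
  obtain ⟨Ψs, hGs, hWs⟩ : ∃ Ψs : E3 → E3, IsGlobalReg Cg' η R S (LayeredHom (L : E3 →L[ℝ] E3) w) Ψs ∧
      wildMass tameRadius (atomsIn (μS S) 0 R) Ψs ≤ εw * η * nK (atomsIn (μS S) 0 R) := by
    rcases lt_or_ge (η * nK (atomsIn (μS S) 0 R)) (tameRadius ^ 2 / (2 * Cg)) with hthin | hfat
    · -- THIN window: no wild bond at the tame radius; keep `Ψ`, upgraded to the constant `Cg'`
      refine ⟨Ψ, isGlobalReg_mono hCgCg' hη.le hRpos hG, ?_⟩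
      obtain ⟨τ, hτ⟩ := hG.2.2.2 R le_rfl
      have hlev : Cg * (R / R) * η * nK (atomsIn (μS S) 0 R) < tameRadius ^ 2 := by
        rw [div_self hRpos.ne', mul_one]
        calc Cg * η * nK (atomsIn (μS S) 0 R) = Cg * (η * nK (atomsIn (μS S) 0 R)) := by ring
          _ < Cg * (tameRadius ^ 2 / (2 * Cg)) := mul_lt_mul_of_pos_left hthin hCg0
          _ = tameRadius ^ 2 / 2 := by field_simp
          _ ≤ tameRadius ^ 2 := by linarith [sq_nonneg tameRadius]
      rw [wildMass_eq_zero_of_registered hτ hfin tameRadius_pos hlev]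
      exact mul_nonneg (mul_nonneg hεw.le hη.le) hN
    · -- FAT window: (R_W) re-registers at `Cg'`
      exact hW'' S hSd hg η hη hηW' R hRW' L w hEq Ψ hG hfat
  -- (FF): the tail force is `εf`-dual-small; (E): the linearisation residual is `(C_E√η + C_ℓ·εf)`-, hence `εr`-dual-small
  have hFD := hF'' S hSd.1 hg η hη hηF' R hRF' L w hEq Ψs hGs
  have hres := hE'' S hSd.1 hg η hη hηE' R hRE' L w hEq Ψs hGs εf hεf hFD
  have hsmall : CE * Real.sqrt η + Cl * εf ≤ εr := by
    have hsq : Real.sqrt η ≤ εr / (2 * CE) := by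
      calc Real.sqrt η ≤ Real.sqrt ηs := Real.sqrt_le_sqrt hηs'
        _ = εr / (2 * CE) := by rw [hηs_def]; exact Real.sqrt_sq (by positivity)
    have h1 : CE * Real.sqrt η ≤ εr / 2 := by
      calc CE * Real.sqrt η ≤ CE * (εr / (2 * CE)) := mul_le_mul_of_nonneg_left hsq hCE0.le
        _ = εr / 2 := by field_simp
    have h2 : Cl * εf = εr / 2 := by rw [hεf_def]; field_simp
    linarith
  have hres' := linResidualSmall_mono hsmall hres
  -- (A⁰): the truncated-harmonic approximant `h`, position-close at level `ε`
  obtain ⟨h, hharm, hgrad, hclose⟩ := hA''' S hSd.1 hg η hη hηA' R hRA' L w hEq Ψs hGs hres'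
  have hr2 : 2 * t * R ≤ R / 64 := by
    have h := mul_le_mul_of_nonneg_left ht128 hRpos.le
    linarith
  have hclose2 := hclose (2 * t * R) (by positivity) hr2
  -- (D⁰): an affine-layered Taylor field `T` at the sub-window `win 2tR`
  obtain ⟨T, hTaff, hdec⟩ := hD'' S hSd.1 hg η hη hηD' R hRD' L w hEq Ψs hGs h hharm hgrad
  -- (C♭): position-level Caccioppoli at `t·R`, levels rewritten in units `(tR)²·t³·nK(win R)`
  have e1 : ε * η * R ^ 2 * nK (atomsIn (μS S) 0 R) = ε * η / t ^ 5 * (t * R) ^ 2 * (t ^ 3 * nK (atomsIn (μS S) 0 R)) := by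
    field_simp
  have e2 : CD * t ^ 7 * R ^ 2 * η * nK (atomsIn (μS S) 0 R) = CD * η * t ^ 2 * (t * R) ^ 2 * (t ^ 3 * nK (atomsIn (μS S) 0 R)) := by
    ring
  have e3 : εw * η * nK (atomsIn (μS S) 0 R) = εw * η / t ^ 3 * (t ^ 3 * nK (atomsIn (μS S) 0 R)) := by
    field_simp
  rw [e1] at hclose2
  rw [e2] at hdec
  rw [e3] at hWs
  have hout := hC'' S hSd hg η hη hηb' R hRb' L w hEq Ψs hGs h T hTaff (ε * η / t ^ 5) (CD * η * t ^ 2) (εw * η / t ^ 3)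
    (by positivity) (by positivity) (by positivity) hclose2 hdec hWs
  -- the three levels add up to `≤ c·η`
  have hlev : Cb * (ε * η / t ^ 5 + CD * η * t ^ 2 + εw * η / t ^ 3) ≤ c * η := by
    have f1 : Cb * (ε * η / t ^ 5) = c * η / 3 := by rw [hε_def]; field_simp
    have f2 : Cb * (εw * η / t ^ 3) = c * η / 3 := by rw [hεw_def]; field_simp
    have f3 : Cb * (CD * η * t ^ 2) ≤ c * η / 3 := by
      calc Cb * (CD * η * t ^ 2) = Cb * CD * t ^ 2 * η := by ring
        _ ≤ c / 3 * η := mul_le_mul_of_nonneg_right hCbCDt2 hη.le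
        _ = c * η / 3 := by ring
    calc Cb * (ε * η / t ^ 5 + CD * η * t ^ 2 + εw * η / t ^ 3)
        = Cb * (ε * η / t ^ 5) + Cb * (CD * η * t ^ 2) + Cb * (εw * η / t ^ 3) := by ring
      _ ≤ c * η / 3 + c * η / 3 + c * η / 3 := by linarith
      _ = c * η := by ring
  exact nearHomL2BD_mono hlev hout

/-! ## §VII.2  ★ Columns of architecture (II) (`s = 1/50`; no intermediate `s′`-chart) -/

/-- ★★ **H♭^ℓ,ms ⟸ (P) ∧ (T) ∧ (U♮) ∧ (A0) ∧ (FF) ∧ (E) ∧ (A⁰) ∧ (D⁰) ∧ (C♭) ∧ (R_W) (PROVED)**. [this file, g32] -/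
theorem halvingBasinPGLms_of_ten_pieces {aHi Λ θ s : ℝ} (hP : RegistrationP aHi Λ θ s) (hT : TailDominationCert)
    (hU : UniformTameStability s Λ) (h0 : GlobalChartRegistrationP aHi Λ θ s) (hF : TailForceSlavingP aHi Λ θ s)
    (hE : LipDualLinearisationP aHi Λ θ s) (hA : L2HarmonicApproxP aHi Λ θ s) (hD : PositionDecayPL aHi Λ θ s)
    (hC : PositionCaccioppoliPG aHi Λ θ s) (hW : WildFractionPG aHi Λ θ s) : HalvingBasinPGLms aHi Λ θ s :=
  halvingBasinPGLms_of_reg_contr hP (harmonicContractionPGLms_of_nine_pieces hT hU h0 hF hE hA hD hC hW)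

/-- ★★★ **COLUMN `_16XH7` — SIXTEEN opaque leaves, THE COLUMN OF ARCHITECTURE (II)**: `LatticeLiouvilleCert → LayeredLiouvilleCert →
R_G(1;2,1/16,1/16) → X(1;2,1/16,1/16) → Z_E(1;2,1/16,1/50) → P(1;2,1/16,1/50) → T → U♮(1/50,2) → A0 → FF → E → A⁰ → D⁰ → C♭ → R_W (all at
(1;2,1/16,1/50)) → PeriodicBulkGapDoor 2 → VisibleGap (1/50) ∧ PertRegime (1/50)`.  Residual: (R_W) ALONE, at the FIXED tame radius; the tree leaf (C)
«CaccioppoliPGL» and the `s′ = 1/25` chart do not occur. [this file, g32] -/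
theorem gap_and_pert_1_50_of_certs_16XH7 (hL : LatticeLiouvilleCert) (hL' : LayeredLiouvilleCert)
    (hR : OscRigidityL2BDPG 1 2 (1 / 16) (1 / 16)) (hX : ExcessFlatnessControlP 1 2 (1 / 16) (1 / 16))
    (hE : ExcessChartLocalisationP 1 2 (1 / 16) (1 / 50)) (hP : RegistrationP 1 2 (1 / 16) (1 / 50))
    (hT : TailDominationCert) (hU : UniformTameStability (1 / 50) 2)
    (h0 : GlobalChartRegistrationP 1 2 (1 / 16) (1 / 50)) (hF : TailForceSlavingP 1 2 (1 / 16) (1 / 50))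
    (hE' : LipDualLinearisationP 1 2 (1 / 16) (1 / 50)) (hA : L2HarmonicApproxP 1 2 (1 / 16) (1 / 50))
    (hD : PositionDecayPL 1 2 (1 / 16) (1 / 50)) (hC : PositionCaccioppoliPG 1 2 (1 / 16) (1 / 50))
    (hW : WildFractionPG 1 2 (1 / 16) (1 / 50)) (hG : PeriodicBulkGapDoor 2) : VisibleGap (1 / 50) ∧ PertRegime (1 / 50) :=
  gap_and_pert_1_50_of_certs_16XHlms hL hL' hR hX hE (halvingBasinPGLms_of_ten_pieces hP hT hU h0 hF hE' hA hD hC hW) hG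

/-- ★★ **COLUMN `_16XH7W` — the same column with (A1) «WildReRegistrationPG» (`∀ϑ`) in place of (R_W)** (via (A1) ⇒ (R_W), PROVED): the H¹ column's
residual also closes architecture (II). [this file, g32] -/
theorem gap_and_pert_1_50_of_certs_16XH7W (hL : LatticeLiouvilleCert) (hL' : LayeredLiouvilleCert)
    (hR : OscRigidityL2BDPG 1 2 (1 / 16) (1 / 16)) (hX : ExcessFlatnessControlP 1 2 (1 / 16) (1 / 16))
    (hE : ExcessChartLocalisationP 1 2 (1 / 16) (1 / 50)) (hP : RegistrationP 1 2 (1 / 16) (1 / 50))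
    (hT : TailDominationCert) (hU : UniformTameStability (1 / 50) 2)
    (h0 : GlobalChartRegistrationP 1 2 (1 / 16) (1 / 50)) (hF : TailForceSlavingP 1 2 (1 / 16) (1 / 50))
    (hE' : LipDualLinearisationP 1 2 (1 / 16) (1 / 50)) (hA : L2HarmonicApproxP 1 2 (1 / 16) (1 / 50))
    (hD : PositionDecayPL 1 2 (1 / 16) (1 / 50)) (hC : PositionCaccioppoliPG 1 2 (1 / 16) (1 / 50))
    (h1 : WildReRegistrationPG 1 2 (1 / 16) (1 / 50)) (hG : PeriodicBulkGapDoor 2) : VisibleGap (1 / 50) ∧ PertRegime (1 / 50) :=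
  gap_and_pert_1_50_of_certs_16XH7 hL hL' hR hX hE hP hT hU h0 hF hE' hA hD hC (wildFractionPG_of_wildReRegistrationPG h1) hG

/-- ★ **COLUMN `_16XH7HC` — «nothing lost»: the tree leaves (HD)(1/50,1/25) and (C)(1/25) VERBATIM close the node (HC)** (via HD ⇒ HD^ms and the seam
`harmonicContractionPGLms_of_decayms_cacc`), so the columns `_16XH5/_16XH6` of parts S/TB factor through (HC). [this file, g32] -/
theorem gap_and_pert_1_50_of_certs_16XH7HC (hL : LatticeLiouvilleCert) (hL' : LayeredLiouvilleCert)
    (hR : OscRigidityL2BDPG 1 2 (1 / 16) (1 / 16)) (hX : ExcessFlatnessControlP 1 2 (1 / 16) (1 / 16))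
    (hE : ExcessChartLocalisationP 1 2 (1 / 16) (1 / 50)) (hP : RegistrationP 1 2 (1 / 16) (1 / 50))
    (hHD : HarmonicDecayPGL 1 2 (1 / 16) (1 / 50) (1 / 25)) (hCc : CaccioppoliPGL 1 2 (1 / 16) (1 / 25))
    (hG : PeriodicBulkGapDoor 2) : VisibleGap (1 / 50) ∧ PertRegime (1 / 50) :=
  gap_and_pert_1_50_of_certs_16XHlms hL hL' hR hX hE
    (halvingBasinPGLms_of_reg_contr hP
      (harmonicContractionPGLms_of_decayms_cacc (harmonicDecayPGLms_of_harmonicDecayPGL hHD) hCc)) hG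

end Summit.AtomisticToContinuum.Crystallization.Theorems.ChartedZeroExcessLayeredLatticeLiouville

end
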